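import Literature.AlgebraicGeometry.Motives.AbelianVarietyFrobeniusSemisimpleDescent
import Literature.AlgebraicGeometry.Motives.AbelianVarietyPoincareCompleteReducibility
import Literature.AlgebraicGeometry.Motives.AbelianVarietyTheoremOfCubeProofs
import HarnessLib

/-!
# The endomorphism algebra of an abelian variety is semisimple — unconditionally, over an
# algebraically closed field (Mumford §19, Cor. 2 of Thm. 1) and over a finite field (Tate 1966, §1)

For an abelian variety `X` over a field `K`, `End⁰(X) = ℚ ⊗ End_K(X)` (`AbelianVariety.endAlgebra`,
`Motives/AbelianVariety`). Mumford, *Abelian Varieties*, §19, Cor. 2 of Thm. 1 (p. 174): `End⁰(X)`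
is a semisimple `ℚ`-algebra. In this tree the corollary was proved CONDITIONALLY:

* over any field, from Poincaré's complete reducibility theorem in the shape `hP1` and
  "non-zero homomorphisms of simple abelian varieties are isogenies" (`hsimple`) —
  `AbelianVariety.isSemisimpleRing_endAlgebra_of_mumford19`
  (`Motives/AbelianVarietyEndAlgebraSemisimpleProofs`: Schurian idempotents of a quasi-decomposition
  into simple factors);
* over a finite field `K`, from the Theorem of the Cube and `hP1` over `K̄` —
  `AbelianVariety.isSemisimpleRing_endAlgebra_of_theoremOfCube_of_poincare_algebraicClosure`
  (`Motives/AbelianVarietyFrobeniusSemisimpleDescent`: Cor. 2 over `K̄` descended to `K` through the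
  Frobenius, Tate 1966 §1).

All three inputs are now theorems of the tree — `AbelianVariety.poincare_hP1`
(`Motives/AbelianVarietyPoincareCompleteReducibility`, Mumford §19 Thm. 1 over an algebraically
closed field), `AbelianVariety.hsimple_of_isAlgClosed` (`Motives/AbelianVarietyKernelComponent`) and
`theoremOfCube_linEquiv_holds` (`Motives/AbelianVarietyTheoremOfCubeProofs`) — so this file records
the unconditional statements:

* `AbelianVariety.isSemisimpleRing_endAlgebra_of_isAlgClosed` — `End⁰(X)` is semisimple for every
  abelian variety over an algebraically closed field;
* `AbelianVariety.isSemisimpleRing_endAlgebra_of_finite` — `End⁰_K(P)` is semisimple for every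
  abelian variety over a finite field `K` (the semisimplicity input `hss` of the Tate / Faltings
  assemblies `tate_end_bijective_of_finite_of_endAlgebra`, `faltingsTateMap_bijective_of_exists_infinite_iso`, …).

No definition and no named fact is introduced (D-0026); both proofs are one-line compositions.
(Over an arbitrary field the corollary needs Poincaré reducibility over that field, or a descent of
semisimplicity along `K̄/K`; not recorded here.)

## References

* [MumfordAV1970] D. Mumford, *Abelian Varieties*, TIFR Studies in Mathematics 5 (1970): §19,
  Thm. 1 and Cor. 2 of Thm. 1 (pp. 173–174).
* [Tate1966Endomorphisms] J. Tate, *Endomorphisms of abelian varieties over finite fields*,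
  Invent. Math. 2 (1966), 134–144, §1 ("`End⁰(A)` is semisimple") — not held
  (doi:10.1007/bf01404549); as reported in Milne, *The Work of John Tate*, §4.3 (arXiv:1210.7459,
  held, p. 22).
-/

noncomputable section

universe u

open CategoryTheory CategoryTheory.Limits AlgebraicGeometry

namespace Literature.AlgebraicGeometry.Motives

namespace AbelianVariety

/-- **Mumford §19, Cor. 2 of Thm. 1 over an algebraically closed field: `End⁰(X)` is a semisimple
`ℚ`-algebra**, unconditionally — `isSemisimpleRing_endAlgebra_of_mumford19` with its two inputs
discharged by Poincaré's complete reducibility theorem (`poincare_hP1`) and "non-zero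
homomorphisms of simple abelian varieties are isogenies" (`hsimple_of_isAlgClosed`).
[cite: MumfordAV1970, §19 Cor. 2 of Thm. 1 (p. 174)] -/
theorem isSemisimpleRing_endAlgebra_of_isAlgClosed {K : Type u} [Field K] [IsAlgClosed K]
    (X : AbelianVariety K) : IsSemisimpleRing (endAlgebra X) :=
  isSemisimpleRing_endAlgebra_of_mumford19 (poincare_hP1 K) (hsimple_of_isAlgClosed K) X

/-- **`End⁰_K(P)` is a semisimple `ℚ`-algebra for every abelian variety `P` over a finite field
`K`**, unconditionally (Tate 1966, §1; Milne, *The Work of John Tate*, §4.3) —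
`isSemisimpleRing_endAlgebra_of_theoremOfCube_of_poincare_algebraicClosure` (Mumford §19 Cor. 2
over `K̄` descended through the Frobenius) with the Theorem of the Cube
(`theoremOfCube_linEquiv_holds`) and Poincaré reducibility over `K̄` (`poincare_hP1`) discharged.
[cite: Tate1966Endomorphisms, §1] [cite: MumfordAV1970, §19 Cor. 2 of Thm. 1 (p. 174)] -/
theorem isSemisimpleRing_endAlgebra_of_finite {K : Type u} [Field K] [Finite K]
    (P : AbelianVariety K) : IsSemisimpleRing (endAlgebra P) :=
  isSemisimpleRing_endAlgebra_of_theoremOfCube_of_poincare_algebraicClosure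
    theoremOfCube_linEquiv_holds (poincare_hP1 (AlgebraicClosure K)) P

end AbelianVariety

end Literature.AlgebraicGeometry.Motives
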